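import Summits.KontsevichZagierPeriods.KontsevichZagierPeriods.Theses.HurwitzMicroSectors

/-!
# Okada's theorem, step (F): residue-class bookkeeping for the Hurwitz-type sums

Elementary identities linking the kernel sums `Σ_k (Lk+a)^{-w}` of the line's normal forms to sums
over residue classes `Z(u) = Σ_{n ≡ u (L)} n^{-w}` (`u : ZMod L`), finite combinations
`Σ_u Λ(u) Z(u) = Σ_n Λ(n) n^{-w}`, their complex `LSeries` form, and the real/imaginary parts of the
cyclotomic double sums `Σ_j Σ_u Λ(u) b_j ζ_L^{j u}`. [folklore]
-/

noncomputable section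

open Complex
open scoped BigOperators

namespace Summit.KontsevichZagierPeriods.Theorems.HurwitzMicroSectorsHurwitzSectorComplement.Okada

variable {L : ℕ} [NeZero L]

/-- `Σ_k (Lk+a)^{-w} = Σ_{n ≡ a (L)} n^{-w}` for `a < L` (reindex `n = Lk + a`). [folklore] -/
theorem tsum_shift_eq_tsum_indicator (w : ℕ) {a : ℕ} (haL : a < L) :
    ∑' k : ℕ, 1 / ((L : ℝ) * k + a) ^ w =
      ∑' n : ℕ, (if (n : ZMod L) = (a : ZMod L) then (1 : ℝ) else 0) / (n : ℝ) ^ w := by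
  have hi : Function.Injective (fun k : ℕ => L * k + a) := fun k k' h => by
    have h' : L * k = L * k' := Nat.add_right_cancel h
    exact Nat.eq_of_mul_eq_mul_left (NeZero.pos L) h'
  have hsupp : Function.support (fun n : ℕ =>
      (if (n : ZMod L) = (a : ZMod L) then (1 : ℝ) else 0) / (n : ℝ) ^ w) ⊆
      Set.range (fun k : ℕ => L * k + a) := by
    intro n hn
    rw [Function.mem_support] at hn
    have h1 : (n : ZMod L) = (a : ZMod L) := by
      by_contra h
      simp [h] at hn
    rw [ZMod.natCast_eq_natCast_iff', Nat.mod_eq_of_lt haL] at h1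
    refine ⟨n / L, ?_⟩
    show L * (n / L) + a = n
    conv_rhs => rw [← Nat.div_add_mod n L]
    rw [h1]
  rw [← hi.tsum_eq hsupp]
  refine tsum_congr fun k => ?_
  have hk : ((L * k + a : ℕ) : ZMod L) = (a : ZMod L) := by
    push_cast
    rw [ZMod.natCast_self, zero_mul, zero_add]
  simp only [hk, if_true]
  push_cast
  rfl

/-- `Σ_k (Lk+L−a)^{-w} = Σ_{n ≡ −a (L)} n^{-w}` for `0 < a < L` (reindex `n = Lk + (L − a)`). [folklore] -/
theorem tsum_shift_neg_eq_tsum_indicator (w : ℕ) {a : ℕ} (ha : 0 < a) (haL : a < L) :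
    ∑' k : ℕ, 1 / ((L : ℝ) * k + ((L : ℝ) - a)) ^ w =
      ∑' n : ℕ, (if (n : ZMod L) = -(a : ZMod L) then (1 : ℝ) else 0) / (n : ℝ) ^ w := by
  have h := tsum_shift_eq_tsum_indicator (L := L) w (a := L - a) (by omega)
  have hc : ((L - a : ℕ) : ℝ) = (L : ℝ) - a := by push_cast [Nat.cast_sub haL.le]; ring
  have hz : ((L - a : ℕ) : ZMod L) = -(a : ZMod L) := by
    rw [Nat.cast_sub haL.le, ZMod.natCast_self, zero_sub]
  rw [hc, hz] at h
  exact h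

omit [NeZero L] in
/-- The residue-class sums are summable pieces of `Σ n^{-w}` (`w ≥ 2`). [folklore] -/
theorem summable_indicator_div_pow (w : ℕ) (hw : 2 ≤ w) (u : ZMod L) :
    Summable fun n : ℕ => (if (n : ZMod L) = u then (1 : ℝ) else 0) / (n : ℝ) ^ w := by
  refine ((Real.summable_one_div_nat_pow (p := w)).mpr (by omega)).of_nonneg_of_le (fun n => ?_)
    fun n => ?_
  · positivity
  · split_ifs
    · exact le_rfl
    · rw [zero_div]; positivity

/-- `Σ_u Λ(u) Z(u) = Σ_n Λ(n) n^{-w}`: a finite combination of residue-class sums is one Dirichlet-type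
series with periodic coefficients. [folklore] -/
theorem sum_mul_tsum_indicator (w : ℕ) (hw : 2 ≤ w) (Λ : ZMod L → ℝ) :
    ∑ u : ZMod L, Λ u * (∑' n : ℕ, (if (n : ZMod L) = u then (1 : ℝ) else 0) / (n : ℝ) ^ w) =
      ∑' n : ℕ, Λ (n : ZMod L) / (n : ℝ) ^ w := by
  simp_rw [← tsum_mul_left]
  rw [← Summable.tsum_finsetSum (fun u _ => (summable_indicator_div_pow w hw u).mul_left _)]
  refine tsum_congr fun n => ?_
  simp only [mul_div_assoc', mul_ite, mul_one, mul_zero]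
  rw [show (∑ u : ZMod L, (if (n : ZMod L) = u then Λ u else 0) / (n : ℝ) ^ w) =
    ∑ u : ZMod L, (if (n : ZMod L) = u then Λ u / (n : ℝ) ^ w else 0) from
    Finset.sum_congr rfl fun u _ => by split_ifs <;> simp]
  rw [Finset.sum_ite_eq, if_pos (Finset.mem_univ _)]

/-- The complex `LSeries` of rational periodic coefficients at `s = w` is the real series
`Σ_n g(n) n^{-w}`. [folklore] -/
theorem LSeries_ratCast_natCast (w : ℕ) (hw : 1 ≤ w) (g : ℕ → ℚ) :
    LSeries (fun n : ℕ => ((g n : ℚ) : ℂ)) (w : ℂ) = (((∑' n : ℕ, (g n : ℝ) / (n : ℝ) ^ w) : ℝ) : ℂ) := by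
  rw [Complex.ofReal_tsum]
  unfold LSeries
  refine tsum_congr fun n => ?_
  rw [LSeries.term_def]
  split_ifs with hn
  · subst hn
    have : (0 : ℝ) ^ w = 0 := zero_pow (by omega)
    simp [this]
  · rw [Complex.cpow_natCast]
    push_cast
    rfl

omit [NeZero L] in
/-- Powers of `ζ_L = exp(2πi/L)` as `exp(θ i)` with a real angle. [folklore] -/
theorem exp_two_pi_div_pow (m : ℕ) :
    Complex.exp (2 * Real.pi * I / L) ^ m = Complex.exp (((2 * Real.pi * m / L : ℝ)) * I) := by
  rw [← Complex.exp_nat_mul]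
  congr 1
  push_cast
  ring

/-- Real part of the cyclotomic double sum `Σ_j Σ_u Λ(u) b_j ζ^{j u}`. [folklore] -/
theorem re_doubleSum (Λ : ZMod L → ℚ) (b : ℕ → ℚ) (s : Finset ℕ) :
    (∑ j ∈ s, ∑ u : ZMod L, ((Λ u * b j : ℚ) : ℂ) * Complex.exp (2 * Real.pi * I / L) ^ (j * u.val)).re =
      ∑ j ∈ s, ∑ u : ZMod L, (Λ u * b j : ℝ) * Real.cos (2 * Real.pi * (j * u.val : ℕ) / L) := by
  rw [Complex.re_sum]
  refine Finset.sum_congr rfl fun j _ => ?_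
  rw [Complex.re_sum]
  refine Finset.sum_congr rfl fun u _ => ?_
  rw [exp_two_pi_div_pow, ← Complex.ofReal_ratCast, Complex.re_ofReal_mul, Complex.exp_ofReal_mul_I_re]
  push_cast
  rfl

/-- Imaginary part of the cyclotomic double sum `Σ_j Σ_u Λ(u) b_j ζ^{j u}`. [folklore] -/
theorem im_doubleSum (Λ : ZMod L → ℚ) (b : ℕ → ℚ) (s : Finset ℕ) :
    (∑ j ∈ s, ∑ u : ZMod L, ((Λ u * b j : ℚ) : ℂ) * Complex.exp (2 * Real.pi * I / L) ^ (j * u.val)).im =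
      ∑ j ∈ s, ∑ u : ZMod L, (Λ u * b j : ℝ) * Real.sin (2 * Real.pi * (j * u.val : ℕ) / L) := by
  rw [Complex.im_sum]
  refine Finset.sum_congr rfl fun j _ => ?_
  rw [Complex.im_sum]
  refine Finset.sum_congr rfl fun u _ => ?_
  rw [exp_two_pi_div_pow, ← Complex.ofReal_ratCast, Complex.im_ofReal_mul, Complex.exp_ofReal_mul_I_im]
  push_cast
  rfl

/-! ### Parity under `u ↦ -u` -/

/-- The angle attached to `(j, -u)`: cosine is unchanged. [folklore] -/
theorem cos_angle_neg (j : ℕ) (u : ZMod L) :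
    Real.cos (2 * Real.pi * ((j * (-u).val : ℕ) : ℝ) / L) =
      Real.cos (2 * Real.pi * ((j * u.val : ℕ) : ℝ) / L) := by
  by_cases hu : u = 0
  · simp [hu]
  have hL : (L : ℝ) ≠ 0 := by exact_mod_cast NeZero.ne L
  rw [ZMod.neg_val, if_neg hu]
  have hle : u.val ≤ L := (ZMod.val_lt u).le
  have : 2 * Real.pi * ((j * (L - u.val) : ℕ) : ℝ) / L =
      (j : ℕ) * (2 * Real.pi) - 2 * Real.pi * ((j * u.val : ℕ) : ℝ) / L := by
    push_cast [Nat.cast_sub hle]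
    field_simp
  rw [this, Real.cos_nat_mul_two_pi_sub]

/-- The angle attached to `(j, -u)`: sine changes sign. [folklore] -/
theorem sin_angle_neg (j : ℕ) (u : ZMod L) :
    Real.sin (2 * Real.pi * ((j * (-u).val : ℕ) : ℝ) / L) =
      -Real.sin (2 * Real.pi * ((j * u.val : ℕ) : ℝ) / L) := by
  by_cases hu : u = 0
  · simp [hu]
  have hL : (L : ℝ) ≠ 0 := by exact_mod_cast NeZero.ne L
  rw [ZMod.neg_val, if_neg hu]
  have hle : u.val ≤ L := (ZMod.val_lt u).le
  have : 2 * Real.pi * ((j * (L - u.val) : ℕ) : ℝ) / L =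
      (j : ℕ) * (2 * Real.pi) - 2 * Real.pi * ((j * u.val : ℕ) : ℝ) / L := by
    push_cast [Nat.cast_sub hle]
    field_simp
  rw [this, Real.sin_nat_mul_two_pi_sub]

/-- A function on `ZMod L` that is odd under `u ↦ -u` sums to zero. [folklore] -/
theorem sum_eq_zero_of_neg {φ : ZMod L → ℝ} (h : ∀ u, φ (-u) = -φ u) : ∑ u : ZMod L, φ u = 0 := by
  have h1 : ∑ u : ZMod L, φ u = ∑ u : ZMod L, φ (-u) :=
    (Fintype.sum_equiv (Equiv.neg (ZMod L)) (fun u => φ (-u)) φ fun u => by simp).symm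
  have h2 : ∑ u : ZMod L, φ (-u) = -∑ u : ZMod L, φ u := by
    rw [← Finset.sum_neg_distrib]
    exact Finset.sum_congr rfl fun u _ => h u
  linarith

/-- For an EVEN coefficient function the sine double sum vanishes. [folklore] -/
theorem sin_doubleSum_eq_zero (Λ : ZMod L → ℚ) (hpar : ∀ u, Λ (-u) = Λ u) (b : ℕ → ℚ)
    (s : Finset ℕ) :
    ∑ j ∈ s, ∑ u : ZMod L, (Λ u * b j : ℝ) * Real.sin (2 * Real.pi * (j * u.val : ℕ) / L) = 0 := by
  refine Finset.sum_eq_zero fun j _ => sum_eq_zero_of_neg fun u => ?_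
  rw [sin_angle_neg, hpar]
  ring

/-- For an ODD coefficient function the cosine double sum vanishes. [folklore] -/
theorem cos_doubleSum_eq_zero (Λ : ZMod L → ℚ) (hpar : ∀ u, Λ (-u) = -Λ u) (b : ℕ → ℚ)
    (s : Finset ℕ) :
    ∑ j ∈ s, ∑ u : ZMod L, (Λ u * b j : ℝ) * Real.cos (2 * Real.pi * (j * u.val : ℕ) / L) = 0 := by
  refine Finset.sum_eq_zero fun j _ => sum_eq_zero_of_neg fun u => ?_
  rw [cos_angle_neg, hpar]
  push_cast
  ring

/-- **Step (F) of Okada's theorem, registered form** (explicit binders): finite combinations of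
residue-class sums are Dirichlet-type series with periodic coefficients. [folklore] -/
theorem okada_stepF : ∀ (L : ℕ) [NeZero L] (w : ℕ), 2 ≤ w → ∀ (Λ : ZMod L → ℝ), ∑ u : ZMod L, Λ u * (∑' n : ℕ, (if (n : ZMod L) = u then (1 : ℝ) else 0) / (n : ℝ) ^ w) = ∑' n : ℕ, Λ (n : ZMod L) / (n : ℝ) ^ w :=
  fun _ _ w hw Λ => sum_mul_tsum_indicator w hw Λ

end Summit.KontsevichZagierPeriods.Theorems.HurwitzMicroSectorsHurwitzSectorComplement.Okada

end
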